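import Mathlib
import Literature.Analysis.FluidPDE.Tao2016AveragedNS.ShiftSetCascadeFlows
import Summits.NavierStokesRegularity.NavierStokesRegularity.Theorems.TaoLadderRungTwoFlatCertificateGlueFieldBoundsOn
import Summits.NavierStokesRegularity.NavierStokesRegularity.Theorems.TaylorModelRungThreeReadoutJets
import Summits.NavierStokesRegularity.NavierStokesRegularity.Theorems.TaylorModelRungThreeSoundness
import HarnessLib

/-!
# Certificate glue on a shift set `𝕊`, XVI: THE EXACT TRUNCATED WINDOW FLOW BY THE METHOD OF MAJORANTS —
  S1 (`TaylorModel.stub_soundness`, abstract Taylor-model soundness, PROVED in the tree) instantiated for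
  the truncated window field of ANY table on ANY shift set (helper for items stmt-NavierStokesRegularity-22987
  `FlatGapCertificatesV2` and stmt-24295 K_A₂(64); cell harvest/h2-tao-ladder, p1 g14)

Glue XIV (`stepCert_of_flowStep`) asks, per mesh step and per start state of the node box, for an EXACT
solution of the truncated (autonomous) window system `ẏ = F₀(y)` on `[0,h]` together with an enclosure. This
module supplies the exact solution ANALYTICALLY, with the Cauchy-majorant enclosure, from ONE table inequality:

* `biFieldOn` — the bilinear form of the truncated field (`truncField Y = biFieldOn Y Y`), linear in each slot;
* `Qc` — the same in weighted window coordinates (`Fin m × Fin W → ℝ`, coordinates `y/ω`), a bilinear map;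
* `qc_bound_of_table` — `Σ_{i₁,i₂,μ} |α| (1+ε₀)^{5(k−μ₃)/2} ω̂_a ω̂_b ≤ b·ω_k` for every window `(i,k)` gives the
  weighted bilinear bound (B) of S1 with unit weights;
* `exists_truncFlow_majorant` — for every state `z` with `|z_{ik}| ≤ m₀ ω_k` on the window and every `h ≥ 0`
  with `b m₀ h < 1` there is an exact solution `ψ` of `ψ̇_{ik} = truncField(ψ)_{ik}` on `[0,h]` from `z` with
  `|ψ_{ik}(u)| ≤ m₀/(1 − b m₀ u)·ω_k` (Tao/Cauchy majorant `m₀/(1 − b m₀ u)`); this is the `hflow` witness of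
  glue XIV with the (crude but honest) majorant box as hull — a certificate-free `StepCert` for short steps,
  and the existence half of every sharper (Taylor-model) step enclosure.

Reuses VERBATIM the generic jets `TaylorModelReadout.taylorJet/varJet` (p-route `taylor-model` of crux K1b-DR)
and `TaylorModel.stub_soundness`; nothing of K1b-DR's certificate format is used.

HONEST FRAMING: Tao-type MODEL lattices (Tao 2016 §4/§6 vocabulary, shift-set parametrised); an existence and
a priori bound for a finite-dimensional polynomial ODE — nothing certified about any particular table, no stub
closed, nothing about the Navier–Stokes equations.
-/

noncomputable section

-- the sub-problem namespace repeats the summit name by design (D-0017)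
set_option linter.dupNamespace false

namespace Summit.NavierStokesRegularity.NavierStokesRegularity.Theorems

open Set Finset Literature.Analysis.FluidPDE Literature.Analysis.FluidPDE.TaoCascade
open Summit.NavierStokesRegularity.NavierStokesRegularity.Theorems.TaylorModelReadout

namespace CertificateGlueOn

variable {m : ℕ}

/-! ### The bilinear form of the truncated field -/

/-- Truncation of a state to the window. [folklore] -/
def truncAt (Kb Ka : ℤ) (U : Fin m → ℤ → ℝ) (i : Fin m) (n : ℤ) : ℝ :=
  if -Kb ≤ n ∧ n ≤ Ka then U i n else 0

/-- The BILINEAR FORM of the truncated window field: slot `1` reads `U`, slot `2` reads `V`.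
[cite: Tao2016AveragedNS, §4 (4.8); cell vocabulary, window-truncated] -/
def biFieldOn (𝕊 : Finset (ℤ × ℤ × ℤ)) (ε₀ : ℝ) (α : Fin m → Fin m → Fin m → ℤ × ℤ × ℤ → ℝ)
    (Kb Ka : ℤ) (U V : Fin m → ℤ → ℝ) (i : Fin m) (k : ℤ) : ℝ :=
  ∑ i₁ : Fin m, ∑ i₂ : Fin m, ∑ μ ∈ 𝕊,
    α i₁ i₂ i μ * (1 + ε₀) ^ ((5 : ℝ) * (k - μ.2.2) / 2) *
      (truncAt Kb Ka U i₁ (k - μ.2.2 + μ.1) * truncAt Kb Ka V i₂ (k - μ.2.2 + μ.2.1))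

variable {𝕊 : Finset (ℤ × ℤ × ℤ)} {ε₀ : ℝ} {α : Fin m → Fin m → Fin m → ℤ × ℤ × ℤ → ℝ} {Kb Ka : ℤ}
  {ω : ℤ → ℝ}

/-- The truncated field is the diagonal of the bilinear form. [cite: Tao2016AveragedNS, §4 (4.8); cell vocabulary, window-truncated] -/
theorem truncField_eq_biFieldOn (Y : Fin m → ℤ → ℝ) (i : Fin m) (k : ℤ) :
    truncField 𝕊 ε₀ α Kb Ka Y i k = biFieldOn 𝕊 ε₀ α Kb Ka Y Y i k := by
  simp only [truncField, quadTermOn, biFieldOn, truncAt]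

/-- Truncation is additive. [folklore] -/
theorem truncAt_add (U U' : Fin m → ℤ → ℝ) (i : Fin m) (n : ℤ) :
    truncAt Kb Ka (U + U') i n = truncAt Kb Ka U i n + truncAt Kb Ka U' i n := by
  unfold truncAt; split_ifs <;> simp

/-- Truncation is homogeneous. [folklore] -/
theorem truncAt_smul (r : ℝ) (U : Fin m → ℤ → ℝ) (i : Fin m) (n : ℤ) :
    truncAt Kb Ka (r • U) i n = r * truncAt Kb Ka U i n := by
  unfold truncAt; split_ifs <;> simp

/-- Additivity in the first slot. [folklore] -/
theorem biFieldOn_add_left (U U' V : Fin m → ℤ → ℝ) :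
    biFieldOn 𝕊 ε₀ α Kb Ka (U + U') V = biFieldOn 𝕊 ε₀ α Kb Ka U V + biFieldOn 𝕊 ε₀ α Kb Ka U' V := by
  funext i k
  simp only [biFieldOn, Pi.add_apply, truncAt_add, add_mul, mul_add, Finset.sum_add_distrib]

/-- Additivity in the second slot. [folklore] -/
theorem biFieldOn_add_right (U V V' : Fin m → ℤ → ℝ) :
    biFieldOn 𝕊 ε₀ α Kb Ka U (V + V') = biFieldOn 𝕊 ε₀ α Kb Ka U V + biFieldOn 𝕊 ε₀ α Kb Ka U V' := by
  funext i k
  simp only [biFieldOn, Pi.add_apply, truncAt_add, mul_add, Finset.sum_add_distrib]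

/-- Homogeneity in the first slot. [folklore] -/
theorem biFieldOn_smul_left (r : ℝ) (U V : Fin m → ℤ → ℝ) :
    biFieldOn 𝕊 ε₀ α Kb Ka (r • U) V = r • biFieldOn 𝕊 ε₀ α Kb Ka U V := by
  funext i k
  simp only [biFieldOn, Pi.smul_apply, smul_eq_mul, truncAt_smul, Finset.mul_sum]
  refine Finset.sum_congr rfl fun i₁ _ => Finset.sum_congr rfl fun i₂ _ => Finset.sum_congr rfl fun μ _ => ?_
  ring

/-- Homogeneity in the second slot. [folklore] -/
theorem biFieldOn_smul_right (r : ℝ) (U V : Fin m → ℤ → ℝ) :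
    biFieldOn 𝕊 ε₀ α Kb Ka U (r • V) = r • biFieldOn 𝕊 ε₀ α Kb Ka U V := by
  funext i k
  simp only [biFieldOn, Pi.smul_apply, smul_eq_mul, truncAt_smul, Finset.mul_sum]
  refine Finset.sum_congr rfl fun i₁ _ => Finset.sum_congr rfl fun i₂ _ => Finset.sum_congr rfl fun μ _ => ?_
  ring

/-! ### Weighted coordinates are linear -/

/-- `wstate` is additive. [folklore] -/
theorem wstate_add (x y : Fin m × Fin (winLen Kb Ka) → ℝ) :
    wstate Kb Ka ω (x + y) = wstate Kb Ka ω x + wstate Kb Ka ω y := by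
  funext i k
  simp only [wstate, Pi.add_apply]
  split_ifs <;> ring

/-- `wstate` is homogeneous. [folklore] -/
theorem wstate_smul (r : ℝ) (x : Fin m × Fin (winLen Kb Ka) → ℝ) :
    wstate Kb Ka ω (r • x) = r • wstate Kb Ka ω x := by
  funext i k
  simp only [wstate, Pi.smul_apply, smul_eq_mul]
  split_ifs <;> ring

/-- `wcoord` is additive. [folklore] -/
theorem wcoord_add (Y Y' : Fin m → ℤ → ℝ) :
    wcoord Kb Ka ω (Y + Y') = wcoord Kb Ka ω Y + wcoord Kb Ka ω Y' := by
  funext c; simp only [wcoord, Pi.add_apply, add_div]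

/-- `wcoord` is homogeneous. [folklore] -/
theorem wcoord_smul (r : ℝ) (Y : Fin m → ℤ → ℝ) :
    wcoord Kb Ka ω (r • Y) = r • wcoord Kb Ka ω Y := by
  funext c; simp only [wcoord, Pi.smul_apply, smul_eq_mul, mul_div_assoc]

/-- The truncated bilinear field IN WEIGHTED WINDOW COORDINATES. [cite: Tao2016AveragedNS, §4 (4.8); cell vocabulary, window-truncated] -/
def Qc (𝕊 : Finset (ℤ × ℤ × ℤ)) (ε₀ : ℝ) (α : Fin m → Fin m → Fin m → ℤ × ℤ × ℤ → ℝ) (Kb Ka : ℤ)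
    (ω : ℤ → ℝ) (x y : Fin m × Fin (winLen Kb Ka) → ℝ) : Fin m × Fin (winLen Kb Ka) → ℝ :=
  wcoord Kb Ka ω (biFieldOn 𝕊 ε₀ α Kb Ka (wstate Kb Ka ω x) (wstate Kb Ka ω y))

/-- `Qc` is linear in the second slot. [folklore] -/
theorem isLinearMap_Qc_right (x : Fin m × Fin (winLen Kb Ka) → ℝ) :
    IsLinearMap ℝ (Qc 𝕊 ε₀ α Kb Ka ω x) := by
  constructor
  · intro y y'; simp only [Qc, wstate_add, biFieldOn_add_right, wcoord_add]
  · intro r y; simp only [Qc, wstate_smul, biFieldOn_smul_right, wcoord_smul]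

/-- `Qc` is linear in the first slot. [folklore] -/
theorem isLinearMap_Qc_left (y : Fin m × Fin (winLen Kb Ka) → ℝ) :
    IsLinearMap ℝ (fun x => Qc 𝕊 ε₀ α Kb Ka ω x y) := by
  constructor
  · intro x x'; simp only [Qc, wstate_add, biFieldOn_add_left, wcoord_add]
  · intro r x; simp only [Qc, wstate_smul, biFieldOn_smul_left, wcoord_smul]

/-! ### The weighted bilinear bound (B) from the table -/

/-- A truncated weighted state is bounded by `N ω̂`. [folklore] -/
theorem abs_truncAt_wstate_le (hω : ∀ k, 0 < ω k) (hKK : 0 ≤ Ka + Kb + 1)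
    {x : Fin m × Fin (winLen Kb Ka) → ℝ} {N : ℝ} (hx : ∀ c, |x c| ≤ N) (i : Fin m) (n : ℤ) :
    |truncAt Kb Ka (wstate Kb Ka ω x) i n| ≤ N * wExt Kb Ka ω n := by
  unfold truncAt wExt
  split_ifs with hn
  · have hlt : (n + Kb).toNat < winLen Kb Ka := by
      unfold winLen; rw [Int.toNat_lt_toNat (by omega)]; omega
    set c : Fin (winLen Kb Ka) := ⟨(n + Kb).toNat, hlt⟩ with hc
    have hsh : shellAt Kb c = n := by
      simp only [shellAt, hc]; rw [Int.toNat_of_nonneg (by omega)]; ring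
    have h1 := wstate_on (ω := ω) x hKK i c
    rw [hsh] at h1
    rw [h1, abs_mul, abs_of_pos (hω n), mul_comm]
    exact mul_le_mul_of_nonneg_right (hx (i, c)) (hω n).le
  · simp

/-- **THE BILINEAR BOUND (B) FROM THE TABLE**: if `Σ_{i₁,i₂,μ} |α| (1+ε₀)^{5(k−μ₃)/2} ω̂_a ω̂_b ≤ b ω_k` on the
window then `|Qc x y|_c ≤ b Nx Ny` whenever `|x| ≤ Nx`, `|y| ≤ Ny` (unit S1-weights). [folklore] -/
theorem qc_bound_of_table (hε : 0 < 1 + ε₀) (hω : ∀ k, 0 < ω k) (hKK : 0 ≤ Ka + Kb + 1) {b : ℝ}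
    (htab : ∀ i k, -Kb ≤ k → k ≤ Ka →
      ∑ i₁ : Fin m, ∑ i₂ : Fin m, ∑ μ ∈ 𝕊,
        |α i₁ i₂ i μ| * (1 + ε₀) ^ ((5 : ℝ) * (k - μ.2.2) / 2) *
          (wExt Kb Ka ω (k - μ.2.2 + μ.1) * wExt Kb Ka ω (k - μ.2.2 + μ.2.1)) ≤ b * ω k) :
    ∀ (x y : Fin m × Fin (winLen Kb Ka) → ℝ) (Nx Ny : ℝ), 0 ≤ Nx → 0 ≤ Ny →
      (∀ c, |x c| ≤ Nx * (fun _ => (1 : ℝ)) c) → (∀ c, |y c| ≤ Ny * (fun _ => (1 : ℝ)) c) →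
        ∀ c, |Qc 𝕊 ε₀ α Kb Ka ω x y c| ≤ b * Nx * Ny * (fun _ => (1 : ℝ)) c := by
  intro x y Nx Ny hNx hNy hx hy c
  simp only [mul_one] at hx hy ⊢
  obtain ⟨h1, h2⟩ := shellAt_mem hKK c.2
  set k := shellAt Kb c.2 with hk
  unfold Qc wcoord
  rw [abs_div, abs_of_pos (hω k), div_le_iff₀ (hω k)]
  unfold biFieldOn
  refine (Finset.abs_sum_le_sum_abs _ _).trans ?_
  have hgoal : ∑ i₁ : Fin m, |∑ i₂ : Fin m, ∑ μ ∈ 𝕊, α i₁ i₂ c.1 μ * (1 + ε₀) ^ ((5 : ℝ) * (k - μ.2.2) / 2) *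
        (truncAt Kb Ka (wstate Kb Ka ω x) i₁ (k - μ.2.2 + μ.1) *
          truncAt Kb Ka (wstate Kb Ka ω y) i₂ (k - μ.2.2 + μ.2.1))| ≤
      Nx * Ny * ∑ i₁ : Fin m, ∑ i₂ : Fin m, ∑ μ ∈ 𝕊,
        |α i₁ i₂ c.1 μ| * (1 + ε₀) ^ ((5 : ℝ) * (k - μ.2.2) / 2) *
          (wExt Kb Ka ω (k - μ.2.2 + μ.1) * wExt Kb Ka ω (k - μ.2.2 + μ.2.1)) := by
    rw [Finset.mul_sum]
    refine Finset.sum_le_sum fun i₁ _ => ?_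
    rw [Finset.mul_sum]
    refine (Finset.abs_sum_le_sum_abs _ _).trans (Finset.sum_le_sum fun i₂ _ => ?_)
    rw [Finset.mul_sum]
    refine (Finset.abs_sum_le_sum_abs _ _).trans (Finset.sum_le_sum fun μ _ => ?_)
    have hc0 : 0 ≤ (1 + ε₀) ^ ((5 : ℝ) * (k - μ.2.2) / 2) := (Real.rpow_pos_of_pos hε _).le
    have ha := abs_truncAt_wstate_le hω hKK hx i₁ (k - μ.2.2 + μ.1)
    have hb := abs_truncAt_wstate_le hω hKK hy i₂ (k - μ.2.2 + μ.2.1)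
    rw [abs_mul, abs_mul, abs_mul, abs_of_nonneg hc0]
    have hw1 : 0 ≤ wExt Kb Ka ω (k - μ.2.2 + μ.1) := wExt_nonneg (fun k => (hω k).le) _
    calc |α i₁ i₂ c.1 μ| * (1 + ε₀) ^ ((5 : ℝ) * (k - μ.2.2) / 2) *
          (|truncAt Kb Ka (wstate Kb Ka ω x) i₁ (k - μ.2.2 + μ.1)| *
            |truncAt Kb Ka (wstate Kb Ka ω y) i₂ (k - μ.2.2 + μ.2.1)|)
        ≤ |α i₁ i₂ c.1 μ| * (1 + ε₀) ^ ((5 : ℝ) * (k - μ.2.2) / 2) *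
          ((Nx * wExt Kb Ka ω (k - μ.2.2 + μ.1)) * (Ny * wExt Kb Ka ω (k - μ.2.2 + μ.2.1))) :=
          mul_le_mul_of_nonneg_left (mul_le_mul ha hb (abs_nonneg _) (mul_nonneg hNx hw1))
            (mul_nonneg (abs_nonneg _) hc0)
      _ = Nx * Ny * (|α i₁ i₂ c.1 μ| * (1 + ε₀) ^ ((5 : ℝ) * (k - μ.2.2) / 2) *
          (wExt Kb Ka ω (k - μ.2.2 + μ.1) * wExt Kb Ka ω (k - μ.2.2 + μ.2.1))) := by ring
  refine hgoal.trans ?_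
  calc Nx * Ny * _ ≤ Nx * Ny * (b * ω k) := mul_le_mul_of_nonneg_left (htab c.1 k h1 h2) (mul_nonneg hNx hNy)
    _ = b * Nx * Ny * ω k := by ring

/-! ### Reindexing to `Fin n` and the exact truncated flow -/

/-- The bilinear field on `Fin (m·W) → ℝ` (S1's state space), through `finProdFinEquiv`. [folklore] -/
def QcN (𝕊 : Finset (ℤ × ℤ × ℤ)) (ε₀ : ℝ) (α : Fin m → Fin m → Fin m → ℤ × ℤ × ℤ → ℝ) (Kb Ka : ℤ)
    (ω : ℤ → ℝ) (x y : Fin (m * winLen Kb Ka) → ℝ) : Fin (m * winLen Kb Ka) → ℝ :=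
  fun d => Qc 𝕊 ε₀ α Kb Ka ω (x ∘ finProdFinEquiv) (y ∘ finProdFinEquiv) (finProdFinEquiv.symm d)

/-- `QcN` is linear in the second slot. [folklore] -/
theorem isLinearMap_QcN_right (x : Fin (m * winLen Kb Ka) → ℝ) :
    IsLinearMap ℝ (QcN 𝕊 ε₀ α Kb Ka ω x) := by
  have hl := isLinearMap_Qc_right (𝕊 := 𝕊) (ε₀ := ε₀) (α := α) (Kb := Kb) (Ka := Ka) (ω := ω)
    (x ∘ finProdFinEquiv)
  constructor
  · intro y y'
    funext d
    have : (y + y') ∘ (finProdFinEquiv : Fin m × Fin (winLen Kb Ka) ≃ Fin (m * winLen Kb Ka)) =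
        y ∘ finProdFinEquiv + y' ∘ finProdFinEquiv := rfl
    simp only [QcN, this, hl.map_add, Pi.add_apply]
  · intro r y
    funext d
    have : (r • y) ∘ (finProdFinEquiv : Fin m × Fin (winLen Kb Ka) ≃ Fin (m * winLen Kb Ka)) =
        r • (y ∘ finProdFinEquiv) := rfl
    simp only [QcN, this, hl.map_smul, Pi.smul_apply]

/-- `QcN` is linear in the first slot. [folklore] -/
theorem isLinearMap_QcN_left (y : Fin (m * winLen Kb Ka) → ℝ) :
    IsLinearMap ℝ (fun x => QcN 𝕊 ε₀ α Kb Ka ω x y) := by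
  have hl := isLinearMap_Qc_left (𝕊 := 𝕊) (ε₀ := ε₀) (α := α) (Kb := Kb) (Ka := Ka) (ω := ω)
    (y ∘ finProdFinEquiv)
  constructor
  · intro x x'
    funext d
    have : (x + x') ∘ (finProdFinEquiv : Fin m × Fin (winLen Kb Ka) ≃ Fin (m * winLen Kb Ka)) =
        x ∘ finProdFinEquiv + x' ∘ finProdFinEquiv := rfl
    simp only [QcN, this, hl.map_add, Pi.add_apply]
  · intro r x
    funext d
    have : (r • x) ∘ (finProdFinEquiv : Fin m × Fin (winLen Kb Ka) ≃ Fin (m * winLen Kb Ka)) =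
        r • (x ∘ finProdFinEquiv) := rfl
    simp only [QcN, this, hl.map_smul, Pi.smul_apply]

/-- **THE EXACT TRUNCATED WINDOW FLOW BY THE METHOD OF MAJORANTS** (see the module docstring).
[cite: Tao2016AveragedNS, §4 Lemma 4.1 (4.8) (the quadratic nonlinearity, local existence); cell vocabulary, window-truncated] -/
theorem exists_truncFlow_majorant (hKb : 0 ≤ Kb) (hKa : 1 ≤ Ka) (hε : 0 < 1 + ε₀) (hω : ∀ k, 0 < ω k)
    {b : ℝ} (hb : 0 ≤ b)
    (htab : ∀ i k, -Kb ≤ k → k ≤ Ka →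
      ∑ i₁ : Fin m, ∑ i₂ : Fin m, ∑ μ ∈ 𝕊,
        |α i₁ i₂ i μ| * (1 + ε₀) ^ ((5 : ℝ) * (k - μ.2.2) / 2) *
          (wExt Kb Ka ω (k - μ.2.2 + μ.1) * wExt Kb Ka ω (k - μ.2.2 + μ.2.1)) ≤ b * ω k)
    {z : Fin m → ℤ → ℝ} {m₀ h : ℝ} (hm₀ : 0 ≤ m₀) (hz : ∀ i k, -Kb ≤ k → k ≤ Ka → |z i k| ≤ m₀ * ω k)
    (hh : 0 ≤ h) (hguard : b * m₀ * h < 1) :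
    ∃ ψ : Fin m → ℤ → ℝ → ℝ,
      (∀ i k, -Kb ≤ k → k ≤ Ka → ψ i k 0 = z i k) ∧
      (∀ i k, -Kb ≤ k → k ≤ Ka → ∀ u ∈ Icc 0 h,
        HasDerivWithinAt (ψ i k) (truncField 𝕊 ε₀ α Kb Ka (slice ψ u) i k) (Icc 0 h) u) ∧
      (∀ u ∈ Icc 0 h, ∀ i k, -Kb ≤ k → k ≤ Ka → |ψ i k u| ≤ m₀ / (1 - b * m₀ * u) * ω k) := by
  have hKK : 0 ≤ Ka + Kb + 1 := by omega
  set e : Fin m × Fin (winLen Kb Ka) ≃ Fin (m * winLen Kb Ka) := finProdFinEquiv with he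
  set Q := QcN 𝕊 ε₀ α Kb Ka ω with hQ
  -- the weighted bilinear bound with unit weights, transported to `Fin n`
  have hB : ∀ (u v : Fin (m * winLen Kb Ka) → ℝ) (Nu Nv : ℝ), 0 ≤ Nu → 0 ≤ Nv →
      (∀ c, |u c| ≤ Nu * (fun _ => (1 : ℝ)) c) → (∀ c, |v c| ≤ Nv * (fun _ => (1 : ℝ)) c) →
      ∀ c, |Q u v c| ≤ b * Nu * Nv * (fun _ => (1 : ℝ)) c := by
    intro u v Nu Nv hNu hNv hu hv d
    have := qc_bound_of_table (𝕊 := 𝕊) (ε₀ := ε₀) (α := α) hε hω hKK htab (u ∘ e) (v ∘ e) Nu Nv hNu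
      hNv (fun c => hu (e c)) (fun c => hv (e c)) (e.symm d)
    simpa [hQ, QcN, he] using this
  obtain ⟨Φ, hΦ0, -, hΦ⟩ :=
    Summit.NavierStokesRegularity.NavierStokesRegularity.Theorems.TaylorModel.stub_soundness
      (m * winLen Kb Ka) Q (fun _ => 1) b (taylorJet Q) (varJet Q) (fun _ => one_pos) hb
      (isLinearMap_QcN_right) (isLinearMap_QcN_left) hB (taylorJet_zero Q) (taylorJet_succ_apply Q)
      (varJet_zero Q) (varJet_succ_apply Q)
  -- the start point in coordinates
  set x : Fin (m * winLen Kb Ka) → ℝ := fun d => wcoord Kb Ka ω z (e.symm d) with hx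
  have hxe : x ∘ e = wcoord Kb Ka ω z := by funext c; simp [hx]
  have hxb : ∀ d, |x d| ≤ m₀ * (fun _ => (1 : ℝ)) d := by
    intro d
    simp only [hx, mul_one]
    obtain ⟨h1, h2⟩ := shellAt_mem hKK (e.symm d).2
    unfold wcoord
    rw [abs_div, abs_of_pos (hω _), div_le_iff₀ (hω _)]
    exact hz _ _ h1 h2
  obtain ⟨hsol, -, hval, -⟩ := hΦ x m₀ h hm₀ hxb hh hguard
  -- the flow in cascade coordinates
  refine ⟨fun i k u => wstate Kb Ka ω ((Φ x u) ∘ e) i k, fun i k hk1 hk2 => ?_, fun i k hk1 hk2 u hu => ?_,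
    fun u hu i k hk1 hk2 => ?_⟩
  · -- start
    show wstate Kb Ka ω ((Φ x 0) ∘ e) i k = z i k
    rw [hΦ0, hxe, wstate_wcoord hω z i hk1 hk2]
  · -- the window equation
    have hlt : (k + Kb).toNat < winLen Kb Ka := by
      unfold winLen; rw [Int.toNat_lt_toNat (by omega)]; omega
    set c : Fin (winLen Kb Ka) := ⟨(k + Kb).toNat, hlt⟩ with hc
    have hsh : shellAt Kb c = k := by
      simp only [shellAt, hc]; rw [Int.toNat_of_nonneg (by omega)]; ring
    have hfun : (fun u => wstate Kb Ka ω ((Φ x u) ∘ e) i k) = fun u => ω k * Φ x u (e (i, c)) := by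
      funext u
      have := wstate_on (ω := ω) ((Φ x u) ∘ e) hKK i c
      rw [hsh] at this
      simpa using this
    dsimp only
    rw [hfun]
    have hd := (hasDerivWithinAt_pi.1 (hsol u hu) (e (i, c))).const_mul (ω k)
    refine hd.congr_deriv ?_
    -- identify the derivative with the truncated field of the slice
    have hslice : slice (fun i k u => wstate Kb Ka ω ((Φ x u) ∘ e) i k) u = wstate Kb Ka ω ((Φ x u) ∘ e) := by
      funext i' k'; rfl
    rw [hslice, truncField_eq_biFieldOn]
    have hQapp : Q (Φ x u) (Φ x u) (e (i, c)) =
        biFieldOn 𝕊 ε₀ α Kb Ka (wstate Kb Ka ω ((Φ x u) ∘ e)) (wstate Kb Ka ω ((Φ x u) ∘ e)) i k / ω k := by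
      simp only [hQ, QcN, Qc, he, Equiv.symm_apply_apply, wcoord]
      rw [← he, hsh]
    rw [hQapp]
    field_simp [(hω k).ne']
  · -- the majorant bound
    have hlt : (k + Kb).toNat < winLen Kb Ka := by
      unfold winLen; rw [Int.toNat_lt_toNat (by omega)]; omega
    set c : Fin (winLen Kb Ka) := ⟨(k + Kb).toNat, hlt⟩ with hc
    have hsh : shellAt Kb c = k := by
      simp only [shellAt, hc]; rw [Int.toNat_of_nonneg (by omega)]; ring
    have hv := hval u hu (e (i, c))
    simp only [mul_one] at hv
    have := wstate_on (ω := ω) ((Φ x u) ∘ e) hKK i c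
    rw [hsh] at this
    show |wstate Kb Ka ω ((Φ x u) ∘ e) i k| ≤ _
    rw [this, abs_mul, abs_of_pos (hω k), mul_comm]
    exact mul_le_mul_of_nonneg_right (by simpa using hv) (hω k).le

end CertificateGlueOn

end Summit.NavierStokesRegularity.NavierStokesRegularity.Theorems

end
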